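import Summits.HubbardSuperconductivity.HubbardSuperconductivity.Theorems.AnisotropyChordTransferFibre3Equivariance
import Summits.HubbardSuperconductivity.HubbardSuperconductivity.Theorems.AnisotropyChordTransferFibre3KreinV2
import Summits.HubbardSuperconductivity.HubbardSuperconductivity.Theorems.AnisotropyChordTransferFibre3NDeriv

/-!
# Route `AnisotropyChord` / H0 rotor rung: PORT N30-A — THEOREM KREIN-3, backward half: a fixed point of `Φ` is an eigenvalue

Memo ROTOR-THEORY-20 §278 (theory seat `hubbard-h0-rotor-theory-1`, cycle 20).  For `T < 2ε₁` with `𝒩(T)` invertible and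
`Φ(T) = T` (`L ≥ 4`, `Δ ≠ 0`): let `x = 𝒩⁻¹v`, read it as a charge `f` on `D ∪ S`, and put `Ψ = v − G_T f`.  The rows of
`𝒩x = v` are exactly `Ψ|_D = 0` and `ΔWΨ = −f` on `S`; uniqueness of the solution of `𝒩x = v` together with the equivariance
of `G_T` (`…Fibre3Equivariance`) makes `f` — hence `Ψ` — symmetric; then `Πf = (⟨v,f⟩/3V²)v = T·v` because
`⟨v,f⟩ = ⟨v,𝒩⁻¹v⟩` is real (`𝒩` Hermitian) with real part `3V²Φ(T) = 3V²T`, so `(H₀ − E)Ψ = −f` and the eigen-equation holds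
off `D`; `⟨v,Ψ⟩ = 3V² ≠ 0`.  Result: **`isSectorEigenvalue_of_fixedPoint`** and the full **`kreinThreeV2_holds`**
(`KreinThreeV2 L Δ` for `L ≥ 4`, `Δ ≠ 0`).
Prover seat `hubbard-h0-rotor-p1` g21; helper for stmt-HubbardSuperconductivity-19089 (`--supports`).
-/

set_option linter.dupNamespace false
set_option autoImplicit false

noncomputable section

open scoped BigOperators
open Complex Matrix

namespace Summit.HubbardSuperconductivity.HubbardSuperconductivity.Theorems.AnisotropyChord.Transfer.Fibre3

variable (L : ℕ) [NeZero L]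

/-! ## Small facts -/

/-- `v` is symmetric. [folklore] -/
theorem isSymm_vfun : IsSymm L (K1 L) (vfun L) := by
  unfold IsSymm vfun
  refine ⟨fun c => by ring, fun c => ?_⟩
  have h1 := phase_mul_neg L (K1 L) c.1
  have h2 : phase L (K1 L) c.1 * phase L (K1 L) (c.2 - c.1) = phase L (K1 L) c.2 := by
    rw [← phase_add]; congr 1; abel
  linear_combination h1 + h2

/-- `H₀ v = ε₁ v` pointwise (`L ≥ 2`). [folklore] -/
theorem H0apply_vfun (hL : 2 ≤ L) (c : Cfg L) : H0apply L (K1 L) (vfun L) c = (eps1 L : ℂ) * vfun L c := by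
  obtain ⟨e0, e1, e2⟩ := efree_pole L hL
  have hv : vfun L = fun c => pw L 0 0 c + pw L (K1 L) 0 c + pw L 0 (K1 L) c := by
    funext c; rw [pw_pole₀, pw_pole₁, pw_pole₂]; rfl
  have hadd : ∀ (A B C : Cfg L → ℂ) (d : Cfg L),
      H0apply L (K1 L) (fun e => A e + B e + C e) d = H0apply L (K1 L) A d + H0apply L (K1 L) B d + H0apply L (K1 L) C d := by
    intro A B C d; simp only [H0apply_four, hopT]; ring
  rw [hv, hadd, H0apply_pw, H0apply_pw, H0apply_pw]
  unfold efree at e0 e1 e2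
  simp only at e0 e1 e2
  rw [e0, e1, e2]
  show _ = (eps1 L : ℂ) * (pw L 0 0 c + pw L (K1 L) 0 c + pw L 0 (K1 L) c)
  ring

omit [NeZero L] in
/-- [folklore] -/
theorem InS_swap (c : Cfg L) : InS L (c.2, c.1) = InS L c := by
  unfold InS; rw [InD_swap, Wcount_swap]

omit [NeZero L] in
/-- [folklore] -/
theorem InS_U12 (c : Cfg L) : InS L (-c.1, c.2 - c.1) = InS L c := by
  unfold InS; rw [InD_U12, Wcount_U12]

omit [NeZero L] in
/-- [folklore] -/
theorem InD_false_of_InS {c : Cfg L} (h : InS L c = true) : InD L c = false := by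
  cases hD : InD L c
  · rfl
  · have := InS_of_InD L hD; rw [h] at this; exact absurd this (by simp)

/-- `⟨v, G_T F⟩ = 0` (`v` lies in the pole space). [folklore] -/
theorem ip_vfun_Gapply (T : ℝ) (F : Cfg L → ℂ) : ip L (vfun L) (Gapply L T F) = 0 := by
  have p0 : IsPoleK1 L 0 0 = true := (isPoleK1_iff L (0, 0)).2 (Or.inl rfl)
  have p1 : IsPoleK1 L (K1 L) 0 = true := (isPoleK1_iff L (K1 L, 0)).2 (Or.inr (Or.inl rfl))
  have p2 : IsPoleK1 L 0 (K1 L) = true := (isPoleK1_iff L (0, K1 L)).2 (Or.inr (Or.inr rfl))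
  have hv : vfun L = (pw L 0 0 + pw L (K1 L) 0) + pw L 0 (K1 L) := by
    funext c; simp only [Pi.add_apply]; rw [pw_pole₀, pw_pole₁, pw_pole₂]; rfl
  rw [hv, ip_add_left, ip_add_left,
    show pw L 0 0 = pw L ((0, 0) : Tor L × Tor L).1 ((0, 0) : Tor L × Tor L).2 from rfl, ip_pw_Gapply,
    show pw L (K1 L) 0 = pw L ((K1 L, 0) : Tor L × Tor L).1 ((K1 L, 0) : Tor L × Tor L).2 from rfl, ip_pw_Gapply,
    show pw L 0 (K1 L) = pw L ((0, K1 L) : Tor L × Tor L).1 ((0, K1 L) : Tor L × Tor L).2 from rfl, ip_pw_Gapply]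
  unfold gcoef
  simp [p0, p1, p2]

/-- `⟨v, v⟩ = 3V²`. [folklore] -/
theorem ip_vfun_vfun (hL : 2 ≤ L) : ip L (vfun L) (vfun L) = 3 * ((L : ℂ) ^ 2) ^ 2 := by
  classical
  have hK := K1_ne_zero L hL
  rw [ip_vfun_eq L (isSymm_vfun L)]
  have hv : vfun L = (pw L 0 0 + pw L (K1 L) 0) + pw L 0 (K1 L) := by
    funext c; simp only [Pi.add_apply]; rw [pw_pole₀, pw_pole₁, pw_pole₂]; rfl
  rw [hv, ip_add_right, ip_add_right,
    show pw L 0 0 = pw L ((0, 0) : Tor L × Tor L).1 ((0, 0) : Tor L × Tor L).2 from rfl,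
    show pw L (K1 L) 0 = pw L ((K1 L, 0) : Tor L × Tor L).1 ((K1 L, 0) : Tor L × Tor L).2 from rfl,
    show pw L 0 (K1 L) = pw L ((0, K1 L) : Tor L × Tor L).1 ((0, K1 L) : Tor L × Tor L).2 from rfl,
    ip_pw_pw, ip_pw_pw, ip_pw_pw]
  have h1 : ((K1 L, (0 : Tor L)) : Tor L × Tor L) ≠ (0, 0) := fun h => hK (congrArg Prod.fst h)
  have h2 : ((K1 L, (0 : Tor L)) : Tor L × Tor L) ≠ (0, K1 L) := fun h => hK (congrArg Prod.fst h)
  simp [h1, h2]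

/-- `⟨v, M v⟩` is real for Hermitian `M`. [folklore] -/
theorem conj_form_of_hermitian {ι : Type} [Fintype ι] (M : Matrix ι ι ℂ) (hM : Mᴴ = M) (v : ι → ℂ) :
    (starRingEnd ℂ) (star v ⬝ᵥ M *ᵥ v) = star v ⬝ᵥ M *ᵥ v := by
  simp only [dotProduct, Matrix.mulVec, Pi.star_apply, star_def, map_sum, map_mul, Complex.conj_conj,
    Finset.mul_sum]
  conv_lhs => rw [Finset.sum_comm]
  refine Finset.sum_congr rfl fun i _ => Finset.sum_congr rfl fun j _ => ?_
  have h := congrFun (congrFun hM i) j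
  rw [Matrix.conjTranspose_apply, star_def] at h
  rw [← h]; ring

/-! ## The solution of `𝒩 x = v` read as a charge on `D ∪ S` -/

/-- `x = 𝒩(T)⁻¹ v`. [folklore] -/
def xsol (T Δ : ℝ) : DS L → ℂ := (Nmat L T Δ)⁻¹ *ᵥ vpole L

/-- the charge `f`: `x` read on the configuration space, `0` off `D ∪ S`. [folklore] -/
def fsol (T Δ : ℝ) : Cfg L → ℂ := fun c =>
  if h : InD L c = true then xsol L T Δ (Sum.inl ⟨c, h⟩)
  else if h' : InS L c = true then xsol L T Δ (Sum.inr ⟨c, h'⟩) else 0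

/-- [folklore] -/
theorem fsol_D (T Δ : ℝ) (c : Cfg L) (h : InD L c = true) : fsol L T Δ c = xsol L T Δ (Sum.inl ⟨c, h⟩) := by
  unfold fsol; rw [dif_pos h]

/-- [folklore] -/
theorem fsol_S (T Δ : ℝ) (c : Cfg L) (h : InS L c = true) : fsol L T Δ c = xsol L T Δ (Sum.inr ⟨c, h⟩) := by
  have hD := InD_false_of_InS L h
  unfold fsol; rw [dif_neg (by simp [hD]), dif_pos h]

/-- [folklore] -/
theorem fsol_zero (T Δ : ℝ) (c : Cfg L) (hD : InD L c = false) (hS : InS L c = false) : fsol L T Δ c = 0 := by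
  unfold fsol; rw [dif_neg (by simp [hD]), dif_neg (by simp [hS])]

/-- [folklore] -/
theorem fsol_cfgOf (T Δ : ℝ) (j : DS L) : fsol L T Δ (cfgOf L j) = xsol L T Δ j := by
  rcases j with d | s
  · exact fsol_D L T Δ d.1 d.2
  · exact fsol_S L T Δ s.1 s.2

/-- `𝒩 x = v`. [folklore] -/
theorem Nmat_xsol {T Δ : ℝ} (hdet : (Nmat L T Δ).det ≠ 0) : Nmat L T Δ *ᵥ xsol L T Δ = vpole L := by
  unfold xsol
  rw [Matrix.mulVec_mulVec, Matrix.mul_nonsing_inv _ (isUnit_iff_ne_zero.mpr hdet), Matrix.one_mulVec]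

/-- a charge `g` on `D ∪ S` solves the boundary system iff its `D ⊕ S`-reading solves `𝒩 x = v`. [folklore] -/
theorem Nmat_mulVec_of_boundary (T Δ : ℝ) (g : Cfg L → ℂ) (hg0 : ∀ c, InD L c = false → InS L c = false → g c = 0)
    (hgD : ∀ c, InD L c = true → Gapply L T g c = vfun L c)
    (hgS : ∀ c, InS L c = true → Gapply L T g c - (((1 / (Δ * (Wcount L c : ℝ))) : ℝ) : ℂ) * g c = vfun L c) :
    Nmat L T Δ *ᵥ (fun j => g (cfgOf L j)) = vpole L := by
  funext i
  rcases i with d | s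
  · rw [Nmat_mulVec_inl, sum_Gentry_DS L T g hg0]; exact hgD d.1 d.2
  · rw [Nmat_mulVec_inr, sum_Gentry_DS L T g hg0]; exact hgS s.1 s.2

/-- the boundary equations for `f`: on `D`, `G_T f = v`. [folklore] -/
theorem fsol_boundary_D {T Δ : ℝ} (hdet : (Nmat L T Δ).det ≠ 0) (c : Cfg L) (h : InD L c = true) :
    Gapply L T (fsol L T Δ) c = vfun L c := by
  have e := congrFun (Nmat_xsol L hdet) (Sum.inl ⟨c, h⟩)
  rw [Nmat_mulVec_inl] at e
  simp_rw [← fsol_cfgOf] at e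
  rw [sum_Gentry_DS L T (fsol L T Δ) (fsol_zero L T Δ)] at e
  exact e

/-- the boundary equations for `f`: on `S`, `G_T f − f/(ΔW) = v`. [folklore] -/
theorem fsol_boundary_S {T Δ : ℝ} (hdet : (Nmat L T Δ).det ≠ 0) (c : Cfg L) (h : InS L c = true) :
    Gapply L T (fsol L T Δ) c - (((1 / (Δ * (Wcount L c : ℝ))) : ℝ) : ℂ) * fsol L T Δ c = vfun L c := by
  have e := congrFun (Nmat_xsol L hdet) (Sum.inr ⟨c, h⟩)
  rw [Nmat_mulVec_inr] at e
  simp_rw [← fsol_cfgOf] at e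
  rw [sum_Gentry_DS L T (fsol L T Δ) (fsol_zero L T Δ)] at e
  exact e

/-- **uniqueness:** any charge on `D ∪ S` solving the boundary system equals `f`. [folklore] -/
theorem fsol_unique {T Δ : ℝ} (hdet : (Nmat L T Δ).det ≠ 0) (g : Cfg L → ℂ)
    (hg0 : ∀ c, InD L c = false → InS L c = false → g c = 0)
    (hgD : ∀ c, InD L c = true → Gapply L T g c = vfun L c)
    (hgS : ∀ c, InS L c = true → Gapply L T g c - (((1 / (Δ * (Wcount L c : ℝ))) : ℝ) : ℂ) * g c = vfun L c) :
    g = fsol L T Δ := by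
  have hNx' := Nmat_mulVec_of_boundary L T Δ g hg0 hgD hgS
  have hNx := Nmat_xsol L hdet (Δ := Δ)
  have hxx : (fun j => g (cfgOf L j)) = xsol L T Δ := by
    by_contra hne
    apply hdet
    apply Matrix.exists_mulVec_eq_zero_iff.mp
    exact ⟨(fun j => g (cfgOf L j)) - xsol L T Δ, sub_ne_zero.mpr hne, by rw [Matrix.mulVec_sub, hNx', hNx, sub_self]⟩
  funext c
  by_cases hD : InD L c = true
  · rw [fsol_D L T Δ c hD]; exact congrFun hxx (Sum.inl ⟨c, hD⟩)
  · by_cases hS : InS L c = true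
    · rw [fsol_S L T Δ c hS]; exact congrFun hxx (Sum.inr ⟨c, hS⟩)
    · rw [hg0 c (by simpa using hD) (by simpa using hS), fsol_zero L T Δ c (by simpa using hD) (by simpa using hS)]

/-- **`f` is symmetric** (uniqueness + equivariance of `G_T`; `L ≥ 4`, `T < 2ε₁`). [folklore] -/
theorem isSymm_fsol (hL : 4 ≤ L) {T Δ : ℝ} (hT : T < 2 * eps1 L) (hdet : (Nmat L T Δ).det ≠ 0) :
    IsSymm L (K1 L) (fsol L T Δ) := by
  have hv := isSymm_vfun L
  rw [isSymm_iff]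
  constructor
  · refine fsol_unique L hdet (swap23 L (fsol L T Δ)) ?_ ?_ ?_
    · intro c hD hS
      show fsol L T Δ (c.2, c.1) = 0
      exact fsol_zero L T Δ _ (by rw [InD_swap]; exact hD) (by rw [InS_swap]; exact hS)
    · intro c hD
      rw [Gapply_swap23 L hL hT, fsol_boundary_D L hdet _ (by rw [InD_swap]; exact hD), hv.1 c]
    · intro c hS
      show Gapply L T (swap23 L (fsol L T Δ)) c - _ * fsol L T Δ (c.2, c.1) = _
      rw [Gapply_swap23 L hL hT, ← Wcount_swap L c, fsol_boundary_S L hdet _ (by rw [InS_swap]; exact hS), hv.1 c]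
  · refine fsol_unique L hdet (U12 L (K1 L) (fsol L T Δ)) ?_ ?_ ?_
    · intro c hD hS
      show phase L (K1 L) c.1 * fsol L T Δ (-c.1, c.2 - c.1) = 0
      rw [fsol_zero L T Δ _ (by rw [InD_U12]; exact hD) (by rw [InS_U12]; exact hS), mul_zero]
    · intro c hD
      rw [Gapply_U12 L hL hT]
      show phase L (K1 L) c.1 * Gapply L T (fsol L T Δ) (-c.1, c.2 - c.1) = _
      rw [fsol_boundary_D L hdet _ (by rw [InD_U12]; exact hD), hv.2 c]
    · intro c hS
      rw [Gapply_U12 L hL hT]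
      show phase L (K1 L) c.1 * Gapply L T (fsol L T Δ) (-c.1, c.2 - c.1)
        - _ * (phase L (K1 L) c.1 * fsol L T Δ (-c.1, c.2 - c.1)) = _
      have e := fsol_boundary_S L hdet (Δ := Δ) (-c.1, c.2 - c.1) (by rw [InS_U12]; exact hS)
      rw [Wcount_U12] at e
      rw [← hv.2 c, ← e]
      ring

/-- **`⟨v, f⟩ = 3V²T`** when `Φ(T) = T` (`⟨v,𝒩⁻¹v⟩` is real). [folklore] -/
theorem ip_vfun_fsol {T Δ : ℝ} (hfix : Phi L T Δ = T) :
    ip L (vfun L) (fsol L T Δ) = 3 * ((L : ℂ) ^ 2) ^ 2 * (T : ℂ) := by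
  have h1 : ip L (vfun L) (fsol L T Δ) = star (vpole L) ⬝ᵥ xsol L T Δ := by
    unfold ip
    rw [← sum_DS_eq L (fun c => (starRingEnd ℂ) (vfun L c) * fsol L T Δ c)
      (fun c hD hS => by rw [fsol_zero L T Δ c hD hS, mul_zero])]
    simp only [dotProduct, Pi.star_apply, star_def, fsol_cfgOf]
    rfl
  have hV : (3 * ((L : ℝ) ^ 2) ^ 2) ≠ 0 := by
    have : (L : ℝ) ≠ 0 := by exact_mod_cast (NeZero.ne L)
    positivity
  have hre : (star (vpole L) ⬝ᵥ xsol L T Δ).re = 3 * ((L : ℝ) ^ 2) ^ 2 * T := by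
    unfold Phi at hfix
    unfold xsol
    rw [div_eq_iff hV] at hfix
    linarith
  have him : (star (vpole L) ⬝ᵥ xsol L T Δ).im = 0 := by
    apply Complex.conj_eq_iff_im.mp
    unfold xsol
    apply conj_form_of_hermitian
    rw [Matrix.conjTranspose_nonsing_inv, Nmat_conjTranspose]
  rw [h1, show (3 * ((L : ℂ) ^ 2) ^ 2 * (T : ℂ)) = ((3 * ((L : ℝ) ^ 2) ^ 2 * T : ℝ) : ℂ) by push_cast; ring]
  apply Complex.ext
  · rw [Complex.ofReal_re, hre]
  · rw [Complex.ofReal_im, him]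

/-- **`Π f = T·v`.** [folklore] -/
theorem PiPole_fsol (hL : 4 ≤ L) {T Δ : ℝ} (hT : T < 2 * eps1 L) (hdet : (Nmat L T Δ).det ≠ 0) (hfix : Phi L T Δ = T)
    (c : Cfg L) : PiPole L (fsol L T Δ) c = (T : ℂ) * vfun L c := by
  have hL2 : 2 ≤ L := by omega
  have hV : ((L : ℂ) ^ 2) ^ 2 ≠ 0 := by
    have : (L : ℂ) ≠ 0 := by exact_mod_cast (NeZero.ne L)
    positivity
  have h3 : (3 * ((L : ℂ) ^ 2) ^ 2) ≠ 0 := mul_ne_zero (by norm_num) hV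
  rw [PiPole_symm L hL2 (isSymm_fsol L hL hT hdet), ip_vfun_fsol L hfix, mul_div_cancel_left₀ _ h3]

/-! ## The eigenfunction -/

/-- `Ψ = v − G_T f`. [folklore] -/
def PsiSol (T Δ : ℝ) : Cfg L → ℂ := fun c => vfun L c - Gapply L T (fsol L T Δ) c

/-- **backward half of THEOREM KREIN-3:** a fixed point `Φ(T) = T` (`T < 2ε₁`, `𝒩(T)` invertible) is an eigenvalue
`ε₁ + T` of the symmetric hard-core `K₁` sector (`L ≥ 4`, `Δ ≠ 0`). [folklore] -/
theorem isSectorEigenvalue_of_fixedPoint (hL : 4 ≤ L) {Δ : ℝ} (hΔ : Δ ≠ 0) {T : ℝ} (hT : T < 2 * eps1 L)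
    (hdet : (Nmat L T Δ).det ≠ 0) (hfix : Phi L T Δ = T) : IsSectorEigenvalue L (K1 L) Δ (eps1 L + T) := by
  have hL2 : 2 ≤ L := by omega
  have hv := isSymm_vfun L
  have hf := isSymm_fsol L hL hT hdet (Δ := Δ)
  obtain ⟨hf1, hf2⟩ := (isSymm_iff L (K1 L) _).1 hf
  refine ⟨PsiSol L T Δ, ⟨?_, ?_, ?_⟩, ?_⟩
  · -- symmetric
    unfold IsSymm PsiSol
    constructor
    · intro c
      rw [hv.1 c, ← Gapply_swap23 L hL hT (fsol L T Δ) c, hf1]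
    · intro c
      have e := Gapply_U12 L hL hT (fsol L T Δ) c
      rw [hf2] at e
      unfold U12 at e
      rw [mul_sub, hv.2 c, ← e]
  · -- vanishes on D
    intro c hD
    unfold PsiSol
    rw [fsol_boundary_D L hdet c hD, sub_self]
  · -- nonzero: ⟨v, Ψ⟩ = 3V²
    intro h0
    have hip : ip L (vfun L) (PsiSol L T Δ) = 3 * ((L : ℂ) ^ 2) ^ 2 := by
      unfold PsiSol
      rw [ip_sub_right, ip_vfun_vfun L hL2, ip_vfun_Gapply, sub_zero]
    rw [h0] at hip
    have hz : ip L (vfun L) (0 : Cfg L → ℂ) = 0 := by unfold ip; simp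
    rw [hz] at hip
    have hL0 : (L : ℂ) ≠ 0 := by exact_mod_cast (NeZero.ne L)
    have : (3 * ((L : ℂ) ^ 2) ^ 2) ≠ 0 := mul_ne_zero (by norm_num) (pow_ne_zero _ (pow_ne_zero _ hL0))
    exact this hip.symm
  · -- eigen-equation off D
    intro c hD
    unfold Happly PsiSol
    have e1 := H0E_Gapply L hL hT (fsol L T Δ) c
    have e2 := H0apply_vfun L hL2 c
    have e3 := PiPole_fsol L hL hT hdet hfix c
    rw [H0apply_sub, e2]
    by_cases hS : InS L c = true
    · have eS := fsol_boundary_S L hdet (Δ := Δ) c hS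
      have hWpos : 0 < Wcount L c := Wcount_pos_of_InS L hS
      have hW : (Δ : ℂ) * (Wcount L c : ℂ) * (1 / ((Δ : ℂ) * (Wcount L c : ℂ))) = 1 := by
        rw [mul_one_div_cancel]
        exact mul_ne_zero (by exact_mod_cast hΔ) (by exact_mod_cast (ne_of_gt hWpos))
      push_cast at e1 eS ⊢
      linear_combination (-1 : ℂ) * e1 + e3 + ((Δ : ℂ) * (Wcount L c : ℂ)) * eS + (fsol L T Δ c) * hW
    · have hf0 := fsol_zero L T Δ c hD (by simpa using hS)
      have hW0 : (Wcount L c : ℂ) = 0 := by exact_mod_cast Wcount_eq_zero L hD (by simpa using hS)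
      push_cast at e1 ⊢
      rw [hW0]
      linear_combination (-1 : ℂ) * e1 + e3 - hf0

/-- **THEOREM KREIN-3 (revised form) holds:** for `L ≥ 4`, `Δ ≠ 0`, every `T < 2ε₁` with `𝒩(T)` invertible:
`ε₁ + T` is a symmetric hard-core `K₁` eigenvalue iff `Φ(T) = T`. [folklore] -/
theorem kreinThreeV2_holds (hL : 4 ≤ L) {Δ : ℝ} (hΔ : Δ ≠ 0) : KreinThreeV2 L Δ := by
  intro T hT hdet
  exact ⟨kreinThreeV2_forward L hL hΔ T hT hdet, fun hfix => isSectorEigenvalue_of_fixedPoint L hL hΔ hT hdet hfix⟩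

end Summit.HubbardSuperconductivity.HubbardSuperconductivity.Theorems.AnisotropyChord.Transfer.Fibre3

end
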